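import Summits.AtomisticToContinuum.HydrodynamicLimit.Theorems.JParityClosureLocalSecondLawLedgerDefs
import Summits.AtomisticToContinuum.HydrodynamicLimit.Theorems.JParityClosureEmpiricalEnskogIdentity
import Literature.Analysis.FluidPDE.CollisionalTransferFunctional
import Literature.Analysis.FluidPDE.HardSphereRegularGeometry
import Literature.Analysis.FluidPDE.HardSphereDynamicsProofs

/-!
# Collisional-work regularity for the entropy-ledger line of `JParityClosure.LocalSecondLaw`
(stmt-AtomisticToContinuum-13081, line `exact-entropy-ledger-three-passivities`; support of the stubs
`stub_passivityCollisional` (P2) and `stub_ledger` (L))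

Closed lemmas about the collision statistics of the ledger vocabulary
(`Theorems/JParityClosureLocalSecondLawLedgerDefs.lean`: `nrm`, `vin`, `impulse`, `bondC`, `collSum`, `pexC`,
`Regular`, `EosBand`), in three groups.

1. CONVENTION AUDIT of the contact geometry, made formal.  For an ordered pair `(i, j)` of a configuration `w`
   with `n = sepVec xᵢ xⱼ` (minimal image of `xᵢ − xⱼ`, pointing from `j` to `i`):
   * `bondC`'s segment `l ↦ xⱼ + proj (l • n)` runs from `xⱼ` (`l = 0`) to `xᵢ` (`l = 1`) (`bond_endpoint_one`);
   * for a pair closer than half the period (`‖n‖ < 1/2`, always the case at contact `‖n‖ = ε_N`), the swapped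
     pair has `n ↦ −n`, the same incoming velocities in swapped order, the SAME impulse and the SAME bond weight
     (`nrm_swap`, `vin_swap`, `impulse_swap`, `bondC_swap`): the two ordered pairs of one collision contribute equal
     summands to `T₂coll`, `T₃coll`, whence their factor `1/2`;
   * along a good orbit, at a collision time, `vin` read off the (post-collisional, right-continuous) state IS
     the pair of incoming velocities (`vin_flow_eq_leftLim`, the reflection law is an involution), the guard
     `max · 0` in `impulse` is inactive and `impulse > 0` (`impulse_flow_eq_inner`, `impulse_flow_pos`: the left
     limit is incoming), and the velocity jump of `i` is exactly `Δvᵢ = impulse • nrm` (`vel_sub_leftLim_eq_impulse_smul_nrm`):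
     `impulse` is the normal momentum transferred TO `i`, the scalar of EvenStressEnskog's mark `Ξ_P = a n̂ₖn̂ₗ`
     (crux stmt-13079 evaluates `((w−v)·n̂)₊ n̂ₖn̂ₗ` at the same `(ε⁻¹ sepVec xᵢ xⱼ, v⁻, w⁻)`, verbatim).
   * the collision times in `(0, τ]` of a good orbit form a finite set (`finite_collisionTimes_Ioc`), so the
     `finsum` in `collSum` is an honest finite sum.
2. THE EQUATION-OF-STATE BAND.  Under `EosBand η₀ F`: `deriv f_ex = deriv F` and `Z(η) = 1 + η F′(η)` on
   `(0, η₀)`, both continuous there, `|Z − 1|` bounded on compact sub-bands; on the regular event the reduced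
   coarse density `ρ_r σ³` lies in `[cσ³, η₁] ⊂ (0, η₀)`, so `pexC` is the thermodynamic excess pressure
   `ρ_rθ_r · ρ_rσ³ F′(ρ_rσ³)` there (no `deriv`-junk).
3. THE THERMODYNAMIC CANCELLATION behind P2: with `Y(η) = (3/(2π)) f_ex′(η)` (EvenStressEnskog's contact value,
   = Enskog's `χ`, cf. `hsContactFactor`) and the local-Maxwellian value `B^{kl} = (4π/3)ρ²θ δ_{kl}` of the pair
   functional of the mark `Ξ_P^{kl}`, one has `½ σ³ Y(ρσ³) · (4π/3)ρ²θ = ρθ(Z(ρσ³) − 1) = p_ex` EXACTLY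
   (`enskog_pressure_cancellation`, unconditional algebra over `hsCompressibility η = 1 + η f_ex′(η)`), and with
   the anisotropic part `(8π/15)ρ Σ^dev` of `B^{kl}` the Enskog collisional stress is
   `p_ex 𝟙 + (2/5)(Z − 1)Σ^dev` (`enskog_stress_closed_form`): given an EvenStressEnskog law for the weighted marks,
   `T₂ = T₂smooth + T₂coll` reduces to `−(2/5)∫∫(φ/θ_r)(Z−1)Σ^dev_r:∇u_r`, a `(Z−1)`-weighted copy of `T₁`.

References: H. Spohn, *Large Scale Dynamics of Interacting Particles* (1991), Part I §3; J. H. Irving,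
J. G. Kirkwood, J. Chem. Phys. 18 (1950) 817; R. J. Hardy, J. Chem. Phys. 76 (1982) 622; S. Chapman,
T. G. Cowling, *The Mathematical Theory of Non-uniform Gases* (1970) §16.4.
-/

noncomputable section

namespace Summit.AtomisticToContinuum.HydrodynamicLimit.Theorems.LocalSecondLawLedger

open scoped BigOperators Topology Classical MeasureTheory ENNReal InnerProductSpace
open Filter Set MeasureTheory
open Literature.MathematicalPhysics.KineticTheory
open Literature.Analysis.FluidPDE
open Summit.AtomisticToContinuum.HydrodynamicLimit.Theorems.LocalSecondLawNegative

variable {N : ℕ}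

/-! ## 1. Conventions of the contact geometry -/

/-- The bond segment of `bondC` starts at `xⱼ` (`l = 0`). [folklore] -/
theorem bond_endpoint_zero (w : Phase N) (i j : Fin (N + 1)) :
    (w j).1 + tproj ((0 : ℝ) • (Torus.geometry (Fin 3)).sepVec (w i).1 (w j).1) = (w j).1 := by
  simp [tproj]

/-- The bond segment of `bondC` ends at `xᵢ` (`l = 1`): `xⱼ + proj (sepVec xᵢ xⱼ) = xᵢ` on the torus
(`proj ∘ reprSym = id`). [folklore] -/
theorem bond_endpoint_one (w : Phase N) (i j : Fin (N + 1)) :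
    (w j).1 + tproj ((1 : ℝ) • (Torus.geometry (Fin 3)).sepVec (w i).1 (w j).1) = (w i).1 := by
  simp only [tproj, one_smul, Torus.geometry_sepVec, Torus.proj_reprSym]
  abel

/-- For a pair closer than half the period the minimal-image separation vector is odd under swapping the
pair (`Torus.isHardSphereRegular_geometry.sepVec_comm`). [folklore] -/
theorem sepVec_swap {x y : T3} (h : ‖(Torus.geometry (Fin 3)).sepVec x y‖ < 1 / 2) :
    (Torus.geometry (Fin 3)).sepVec y x = -(Torus.geometry (Fin 3)).sepVec x y :=
  (Torus.isHardSphereRegular_geometry (d := Fin 3) (ε := ‖(Torus.geometry (Fin 3)).sepVec x y‖)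
    (by norm_num at h ⊢; exact h)).sepVec_comm x y le_rfl

/-- Swapping the ordered pair flips the contact normal: `n̂ⱼᵢ = −n̂ᵢⱼ`. [folklore] -/
theorem nrm_swap (ε : ℝ) (w : Phase N) {i j : Fin (N + 1)}
    (h : ‖(Torus.geometry (Fin 3)).sepVec (w i).1 (w j).1‖ < 1 / 2) :
    nrm ε w j i = -nrm ε w i j := by
  simp only [nrm, sepVec_swap h, smul_neg]

/-- Swapping the ordered pair swaps the incoming velocities: `vin w j i = ((vin w i j).2, (vin w i j).1)`
(the reflection law depends only on the line of `n` and is equivariant under the swap). [folklore] -/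
theorem vin_swap (w : Phase N) {i j : Fin (N + 1)}
    (h : ‖(Torus.geometry (Fin 3)).sepVec (w i).1 (w j).1‖ < 1 / 2) :
    vin w j i = ((vin w i j).2, (vin w i j).1) := by
  simp only [vin, sepVec_swap h, reflectVel_neg]
  exact reflectVel_swap _ ((w i).2, (w j).2)

/-- Swapping the ordered pair does not change the impulse: `aⱼᵢ = aᵢⱼ`. [folklore] -/
theorem impulse_swap (ε : ℝ) (w : Phase N) {i j : Fin (N + 1)}
    (h : ‖(Torus.geometry (Fin 3)).sepVec (w i).1 (w j).1‖ < 1 / 2) :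
    impulse ε w j i = impulse ε w i j := by
  simp only [impulse, vin_swap w h, nrm_swap ε w h, inner_neg_right, ← inner_neg_left, neg_sub]

/-- Swapping the ordered pair does not change Hardy's bond weight: the segment from `xᵢ` to `xⱼ` is the segment
from `xⱼ` to `xᵢ` run backwards (`l ↦ 1 − l`). [folklore] -/
theorem bondC_swap (r : ℝ) (w : Phase N) {i j : Fin (N + 1)}
    (h : ‖(Torus.geometry (Fin 3)).sepVec (w i).1 (w j).1‖ < 1 / 2) (x₀ : T3) :
    bondC r w j i x₀ = bondC r w i j x₀ := by
  set n : V3 := (Torus.geometry (Fin 3)).sepVec (w i).1 (w j).1 with hn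
  have hji : (Torus.geometry (Fin 3)).sepVec (w j).1 (w i).1 = -n := sepVec_swap h
  have hxi : (w i).1 = (w j).1 + tproj n := by
    have e := bond_endpoint_one w i j
    rw [one_smul] at e
    exact e.symm
  set f : ℝ → ℝ := fun l => cone r ((w j).1 + tproj (l • n)) x₀ with hf
  have hseg : ∀ l : ℝ, (w i).1 + tproj (l • (-n)) = (w j).1 + tproj ((1 - l) • n) := by
    intro l
    rw [hxi, add_assoc, sub_smul, one_smul, smul_neg, sub_eq_add_neg]
    simp only [tproj, Literature.Analysis.FunctionSpaces.Torus.proj_add]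
  have hL : bondC r w j i x₀ = ∫ l in Set.Icc (0 : ℝ) 1, f (1 - l) := by
    simp only [bondC, hji, hseg, hf]
  have hR : bondC r w i j x₀ = ∫ l in Set.Icc (0 : ℝ) 1, f l := by
    simp only [bondC, hf, hn]
  rw [hL, hR, integral_Icc_eq_integral_Ioc, integral_Icc_eq_integral_Ioc,
    ← intervalIntegral.integral_of_le zero_le_one, ← intervalIntegral.integral_of_le zero_le_one,
    intervalIntegral.integral_comp_sub_left f 1]
  norm_num

/-- On a good orbit the collision times in `(0, τ]` form a finite set: the `finsum` in `collSum` is an honest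
finite sum (`IsHardSphereTrajectory.locFinite`). [folklore] -/
theorem finite_collisionTimes_Ioc {σ : ℝ} (Φ : Flow σ N) {z : Phase N} (hz : z ∈ Φ.good) (τ : ℝ) :
    (collisionTimes (Torus.geometry (Fin 3)) (hsDiameter σ N) (fun t => Φ.flow t z) ∩ Set.Ioc 0 τ).Finite :=
  ((Φ.isTrajectory z hz).locFinite 0 τ).subset
    (Set.inter_subset_inter_right _ Set.Ioc_subset_Icc_self)

section Orbit

variable {σ : ℝ} (Φ : Flow σ N) {z : Phase N}

/-- Torus translation is continuous (hypothesis of the left-limit lemmas). [folklore] -/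
private theorem hG3 : ∀ x : T3, Continuous ((Torus.geometry (Fin 3)).translate x) := fun _ =>
  continuous_const.add Literature.Analysis.FunctionSpaces.Torus.continuous_proj

/-- A contact configuration on a good orbit lies in the contact set of the pair. [folklore] -/
theorem flow_mem_contactSet (hz : z ∈ Φ.good) (s : ℝ) {i j : Fin (N + 1)}
    (hc : ‖(Torus.geometry (Fin 3)).sepVec (Φ.flow s z i).1 (Φ.flow s z j).1‖ = hsDiameter σ N) :
    Φ.flow s z ∈ contactSet (Torus.geometry (Fin 3)) (N + 1) (hsDiameter σ N) i j :=
  mem_contactSet.2 ⟨(Φ.isTrajectory z hz).mem s, hc⟩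

/-- **`vin` is the incoming pair.**  Along a good orbit `γ = Φ. z`, at a state where the pair `(i, j)` is in
contact, `vin (γ s) i j` — the reflection of the right-continuous (post-collisional) velocities in the
separation direction — equals the left limits `(vᵢ(s⁻), vⱼ(s⁻))` (`binary` clause: `γ s = collidePair i j (γ s⁻)`,
and the reflection law is an involution). [folklore] -/
theorem vin_flow_eq_leftLim (hz : z ∈ Φ.good) {s : ℝ} {i j : Fin (N + 1)} (hij : i ≠ j)
    (hc : ‖(Torus.geometry (Fin 3)).sepVec (Φ.flow s z i).1 (Φ.flow s z j).1‖ = hsDiameter σ N) :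
    vin (Φ.flow s z) i j =
      ((Function.leftLim (fun t => Φ.flow t z) s i).2, (Function.leftLim (fun t => Φ.flow t z) s j).2) := by
  have htraj := Φ.isTrajectory z hz
  have hcs := flow_mem_contactSet Φ hz s hc
  have hγ : Φ.flow s z = collidePair (Torus.geometry (Fin 3)) i j (Function.leftLim (fun t => Φ.flow t z) s) :=
    (htraj.eq_collidePair_leftLim hij hcs).2
  have e := reflectVel_collidePair_vel (G := Torus.geometry (Fin 3)) hij
    (Function.leftLim (fun t => Φ.flow t z) s)
  rw [← hγ] at e
  exact e

/-- **The impulse is the normal approach speed of the incoming pair** (the guard `max · 0` is inactive):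
`impulse ε (γ s) i j = ⟪vⱼ(s⁻) − vᵢ(s⁻), n̂⟫` at a contact of `(i, j)` on a good orbit. [folklore] -/
theorem impulse_flow_eq_inner (hz : z ∈ Φ.good) {s : ℝ} {i j : Fin (N + 1)} (hij : i ≠ j)
    (hc : ‖(Torus.geometry (Fin 3)).sepVec (Φ.flow s z i).1 (Φ.flow s z j).1‖ = hsDiameter σ N) :
    impulse (hsDiameter σ N) (Φ.flow s z) i j =
      ⟪(Function.leftLim (fun t => Φ.flow t z) s j).2 - (Function.leftLim (fun t => Φ.flow t z) s i).2,
        nrm (hsDiameter σ N) (Φ.flow s z) i j⟫_ℝ := by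
  have htraj := Φ.isTrajectory z hz
  have hcs := flow_mem_contactSet Φ hz s hc
  have hin : IsIncoming (Torus.geometry (Fin 3)) (Function.leftLim (fun t => Φ.flow t z) s) i j :=
    (htraj.eq_collidePair_leftLim hij hcs).1
  have hpos : ∀ k, (Function.leftLim (fun t => Φ.flow t z) s k).1 = (Φ.flow s z k).1 :=
    htraj.leftLim_apply_fst hG3 s
  simp only [IsIncoming, hpos] at hin
  rw [impulse, vin_flow_eq_leftLim Φ hz hij hc]
  refine max_eq_left ?_
  simp only [nrm, inner_smul_right]
  refine mul_nonneg (inv_nonneg.2 ?_) ?_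
  · rw [← hc]; exact norm_nonneg _
  · rw [real_inner_comm, ← neg_sub, inner_neg_right]
    linarith

/-- **The impulse is positive** at a contact of `(i, j)` on a good orbit (the left limit is incoming, no
grazing on the good set). [folklore] -/
theorem impulse_flow_pos (hz : z ∈ Φ.good) {s : ℝ} {i j : Fin (N + 1)} (hij : i ≠ j)
    (hc : ‖(Torus.geometry (Fin 3)).sepVec (Φ.flow s z i).1 (Φ.flow s z j).1‖ = hsDiameter σ N) :
    0 < impulse (hsDiameter σ N) (Φ.flow s z) i j := by
  have htraj := Φ.isTrajectory z hz
  have hcs := flow_mem_contactSet Φ hz s hc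
  have hin : IsIncoming (Torus.geometry (Fin 3)) (Function.leftLim (fun t => Φ.flow t z) s) i j :=
    (htraj.eq_collidePair_leftLim hij hcs).1
  have hpos : ∀ k, (Function.leftLim (fun t => Φ.flow t z) s k).1 = (Φ.flow s z k).1 :=
    htraj.leftLim_apply_fst hG3 s
  simp only [IsIncoming, hpos] at hin
  set n : V3 := (Torus.geometry (Fin 3)).sepVec (Φ.flow s z i).1 (Φ.flow s z j).1 with hn
  have hn0 : n ≠ 0 := by
    intro h0
    rw [h0, inner_zero_left] at hin
    exact lt_irrefl _ hin
  have hε : 0 < hsDiameter σ N := by rw [← hc]; exact norm_pos_iff.2 hn0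
  rw [impulse_flow_eq_inner Φ hz hij hc]
  simp only [nrm, inner_smul_right, ← hn]
  refine mul_pos (inv_pos.2 hε) ?_
  rw [real_inner_comm, ← neg_sub, inner_neg_right]
  linarith

/-- **The velocity jump is `impulse • nrm`.**  At a contact of `(i, j)` on a good orbit,
`vᵢ(s) − vᵢ(s⁻) = a n̂` with `a = impulse ε (γ s) i j` and `n̂ = nrm ε (γ s) i j = ε⁻¹ sepVec xᵢ xⱼ`: the
momentum `a n̂` is transferred TO `i` (and `−a n̂` to `j`), as the docstrings of `impulse`, `T₂coll`, `T₃coll`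
assert. [folklore] -/
theorem vel_sub_leftLim_eq_impulse_smul_nrm' (hz : z ∈ Φ.good) {s : ℝ} {i j : Fin (N + 1)} (hij : i ≠ j)
    (hc : ‖(Torus.geometry (Fin 3)).sepVec (Φ.flow s z i).1 (Φ.flow s z j).1‖ = hsDiameter σ N) :
    (Φ.flow s z i).2 - (Function.leftLim (fun t => Φ.flow t z) s i).2 =
      impulse (hsDiameter σ N) (Φ.flow s z) i j • nrm (hsDiameter σ N) (Φ.flow s z) i j := by
  have htraj := Φ.isTrajectory z hz
  have hcs := flow_mem_contactSet Φ hz s hc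
  rw [impulse_flow_eq_inner Φ hz hij hc, htraj.vel_sub_leftLim_eq_smul hG3 hij hcs]
  set n : V3 := (Torus.geometry (Fin 3)).sepVec (Φ.flow s z i).1 (Φ.flow s z j).1 with hn
  by_cases hn0 : n = 0
  · have h0 : Torus.reprSym ((Φ.flow s z i).1 - (Φ.flow s z j).1) = 0 := hn0
    simp [nrm, h0, hn0]
  have hε : 0 < hsDiameter σ N := by rw [← hc]; exact norm_pos_iff.2 hn0
  have hnsq : ‖n‖ ^ 2 = hsDiameter σ N ^ 2 := by rw [hc]
  simp only [nrm, ← hn, inner_smul_right, smul_smul, hnsq]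
  rw [← neg_sub (Function.leftLim (fun t => Φ.flow t z) s j).2, inner_neg_left]
  congr 1
  field_simp

/-- The partner's jump is the opposite: `vⱼ(s) − vⱼ(s⁻) = −a n̂`. [folklore] -/
theorem vel_sub_leftLim_right_eq_neg_impulse_smul_nrm (hz : z ∈ Φ.good) {s : ℝ} {i j : Fin (N + 1)}
    (hij : i ≠ j)
    (hc : ‖(Torus.geometry (Fin 3)).sepVec (Φ.flow s z i).1 (Φ.flow s z j).1‖ = hsDiameter σ N) :
    (Φ.flow s z j).2 - (Function.leftLim (fun t => Φ.flow t z) s j).2 =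
      -(impulse (hsDiameter σ N) (Φ.flow s z) i j • nrm (hsDiameter σ N) (Φ.flow s z) i j) := by
  rw [← vel_sub_leftLim_eq_impulse_smul_nrm' Φ hz hij hc]
  exact (Φ.isTrajectory z hz).vel_sub_leftLim_right_eq_neg hij (flow_mem_contactSet Φ hz s hc)

/-- At contact the pair is closer than half the period as soon as `ε_N < 1/2`, so the swap lemmas apply to
both ordered pairs of every collision. [folklore] -/
theorem norm_sepVec_lt_half_of_contact {s : ℝ} {i j : Fin (N + 1)} (hε : hsDiameter σ N < 1 / 2)
    (hc : ‖(Torus.geometry (Fin 3)).sepVec (Φ.flow s z i).1 (Φ.flow s z j).1‖ = hsDiameter σ N) :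
    ‖(Torus.geometry (Fin 3)).sepVec (Φ.flow s z i).1 (Φ.flow s z j).1‖ < 1 / 2 := by
  rw [hc]; exact hε

end Orbit

/-- **The velocity jump is `impulse • nrm`** (registered form of `vel_sub_leftLim_eq_impulse_smul_nrm'`): along
every good orbit of the frame's flow, at a contact of the ordered pair `(i, j)`, `vᵢ(s) − vᵢ(s⁻) = a n̂` with
`a = impulse ε_N (Φₛz) i j > 0` and `n̂ = nrm ε_N (Φₛz) i j = ε_N⁻¹ sepVec xᵢ xⱼ` — the contact conventions of
`T₂coll`/`T₃coll` (and of EvenStressEnskog's mark `Ξ_P`) are those of the dynamics. [folklore] -/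
theorem vel_sub_leftLim_eq_impulse_smul_nrm :
  ∀ {N : ℕ} {σ : ℝ} (Φ : Flow σ N) {z : Phase N}, z ∈ Φ.good → ∀ {s : ℝ} {i j : Fin (N + 1)}, i ≠ j → ‖(Torus.geometry (Fin 3)).sepVec (Φ.flow s z i).1 (Φ.flow s z j).1‖ = hsDiameter σ N → (Φ.flow s z i).2 - (Function.leftLim (fun t => Φ.flow t z) s i).2 = impulse (hsDiameter σ N) (Φ.flow s z) i j • nrm (hsDiameter σ N) (Φ.flow s z) i j :=
  fun Φ _ hz _ _ _ hij hc => vel_sub_leftLim_eq_impulse_smul_nrm' Φ hz hij hc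

/-! ## 2. The equation-of-state band -/

/-- On the band `(0, η₀)` the excess free energy and its analytic representative have the same derivative
(they agree on a neighbourhood). [folklore] -/
theorem EosBand.deriv_eq {η₀ : ℝ} {F : ℝ → ℝ} (h : EosBand η₀ F) {η : ℝ} (hη : η ∈ Set.Ioo 0 η₀) :
    deriv hsExcessFreeEnergy η = deriv F η := by
  have hnhds : hsExcessFreeEnergy =ᶠ[𝓝 η] F :=
    h.2.2.eventuallyEq_of_mem (mem_of_superset (Ioo_mem_nhds hη.1 hη.2) Ioo_subset_Ico_self)
  exact hnhds.deriv_eq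

/-- On the band the compressibility factor is the thermodynamic one, `Z(η) = 1 + η F′(η)`. [folklore] -/
theorem EosBand.hsCompressibility_eq {η₀ : ℝ} {F : ℝ → ℝ} (h : EosBand η₀ F) {η : ℝ}
    (hη : η ∈ Set.Ioo 0 η₀) : hsCompressibility η = 1 + η * deriv F η := by
  rw [hsCompressibility, h.deriv_eq hη]

/-- `F` is smooth on the band. [folklore] -/
theorem EosBand.contDiffOn {η₀ : ℝ} {F : ℝ → ℝ} (h : EosBand η₀ F) :
    ContDiffOn ℝ ⊤ F (Set.Ioo (-η₀) η₀) :=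
  h.2.1.contDiffOn_of_completeSpace

/-- `F′` is continuous on the band. [folklore] -/
theorem EosBand.continuousOn_deriv_F {η₀ : ℝ} {F : ℝ → ℝ} (h : EosBand η₀ F) :
    ContinuousOn (deriv F) (Set.Ioo (-η₀) η₀) :=
  (h.contDiffOn.deriv_of_isOpen (m := ⊤) isOpen_Ioo le_top).continuousOn

/-- `deriv f_ex` is continuous on `(0, η₀)`. [folklore] -/
theorem EosBand.continuousOn_deriv {η₀ : ℝ} {F : ℝ → ℝ} (h : EosBand η₀ F) :
    ContinuousOn (deriv hsExcessFreeEnergy) (Set.Ioo 0 η₀) := by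
  refine (h.continuousOn_deriv_F.mono fun η hη => ⟨by linarith [hη.1, hη.2], hη.2⟩).congr fun η hη => ?_
  exact h.deriv_eq hη

/-- The compressibility factor is continuous on `(0, η₀)`. [folklore] -/
theorem EosBand.continuousOn_hsCompressibility {η₀ : ℝ} {F : ℝ → ℝ} (h : EosBand η₀ F) :
    ContinuousOn hsCompressibility (Set.Ioo 0 η₀) := by
  have : hsCompressibility = fun η => 1 + η * deriv hsExcessFreeEnergy η := rfl
  rw [this]
  exact continuousOn_const.add (continuousOn_id.mul h.continuousOn_deriv)

/-- `|Z − 1|` and `|f_ex′|` are bounded on every compact sub-band `[a, b] ⊂ (0, η₀)`. [folklore] -/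
theorem EosBand.exists_bound {η₀ : ℝ} {F : ℝ → ℝ} (h : EosBand η₀ F) {a b : ℝ} (ha : 0 < a)
    (hb : b < η₀) :
    ∃ K : ℝ, 0 ≤ K ∧ ∀ η ∈ Set.Icc a b,
      |deriv hsExcessFreeEnergy η| ≤ K ∧ |hsCompressibility η - 1| ≤ b * K := by
  have hsub : Set.Icc a b ⊆ Set.Ioo 0 η₀ := fun η hη => ⟨ha.trans_le hη.1, hη.2.trans_lt hb⟩
  by_cases hab : a ≤ b
  · obtain ⟨K, hK⟩ := isCompact_Icc.exists_bound_of_continuousOn (h.continuousOn_deriv.mono hsub)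
    have hK0 : 0 ≤ K := (norm_nonneg _).trans (hK a ⟨le_rfl, hab⟩)
    refine ⟨K, hK0, fun η hη => ?_⟩
    have h1 : |deriv hsExcessFreeEnergy η| ≤ K := by simpa [Real.norm_eq_abs] using hK η hη
    refine ⟨h1, ?_⟩
    have hη0 : 0 ≤ η := (ha.trans_le hη.1).le
    rw [hsCompressibility, add_sub_cancel_left, abs_mul, abs_of_nonneg hη0]
    exact mul_le_mul hη.2 h1 (abs_nonneg _) (hη0.trans hη.2)
  · exact ⟨0, le_rfl, fun η hη => absurd (hη.1.trans hη.2) hab⟩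

/-- On the regular event the reduced coarse density lies in the compact sub-band `[cσ³, η₁]`. [folklore] -/
theorem Regular.rhoC_sigma_mem {σ r τ c η₁ : ℝ} {Φ : Flow σ N} {z : Phase N}
    (h : Regular σ r τ c η₁ Φ z) (hσ : 0 < σ) {s : ℝ} (hs : s ∈ Set.Icc (0 : ℝ) τ) (x : T3) :
    rhoC r (Φ.flow s z) x * σ ^ 3 ∈ Set.Icc (c * σ ^ 3) η₁ :=
  ⟨mul_le_mul_of_nonneg_right (h.rhoC_ge hs x) (pow_pos hσ 3).le, h.rhoC_cap hs x⟩

/-- On the regular event, inside the EOS band (`η₁ < η₀`, floor `c > 0`), the reduced coarse density lies in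
the open band `(0, η₀)`. [folklore] -/
theorem Regular.rhoC_sigma_mem_Ioo {σ r τ c η₁ η₀ : ℝ} {Φ : Flow σ N} {z : Phase N}
    (h : Regular σ r τ c η₁ Φ z) (hσ : 0 < σ) (hc : 0 < c) (hη : η₁ < η₀) {s : ℝ}
    (hs : s ∈ Set.Icc (0 : ℝ) τ) (x : T3) :
    rhoC r (Φ.flow s z) x * σ ^ 3 ∈ Set.Ioo 0 η₀ :=
  have hm := h.rhoC_sigma_mem hσ hs x
  ⟨(mul_pos hc (pow_pos hσ 3)).trans_le hm.1, hm.2.trans_lt hη⟩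

/-- The excess pressure in closed form: `p_ex = ρθ · (ρσ³) f_ex′(ρσ³) = ρθ(Z(ρσ³) − 1)` (unconditional). [folklore] -/
theorem pexC_eq (σ r : ℝ) (w : Phase N) (x₀ : T3) :
    pexC σ r w x₀ = rhoC r w x₀ * thetaC r w x₀ *
      ((rhoC r w x₀ * σ ^ 3) * deriv hsExcessFreeEnergy (rhoC r w x₀ * σ ^ 3)) := by
  unfold pexC hsPressure hsCompressibility; ring

/-- `p_ex = ρθ(Z − 1)`. [folklore] -/
theorem pexC_eq_compressibility (σ r : ℝ) (w : Phase N) (x₀ : T3) :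
    pexC σ r w x₀ = rhoC r w x₀ * thetaC r w x₀ * (hsCompressibility (rhoC r w x₀ * σ ^ 3) - 1) := by
  unfold pexC hsPressure; ring

/-- On the regular event inside the band, `p_ex` is the THERMODYNAMIC excess pressure
`ρ_rθ_r · ρ_rσ³ F′(ρ_rσ³)` (no `deriv`-junk: `f_ex = F` near `ρ_rσ³`). [folklore] -/
theorem Regular.pexC_eq_band {σ r τ c η₁ η₀ : ℝ} {F : ℝ → ℝ} {Φ : Flow σ N} {z : Phase N}
    (hE : EosBand η₀ F) (h : Regular σ r τ c η₁ Φ z) (hσ : 0 < σ) (hc : 0 < c) (hη : η₁ < η₀) {s : ℝ}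
    (hs : s ∈ Set.Icc (0 : ℝ) τ) (x : T3) :
    pexC σ r (Φ.flow s z) x = rhoC r (Φ.flow s z) x * thetaC r (Φ.flow s z) x *
      ((rhoC r (Φ.flow s z) x * σ ^ 3) * deriv F (rhoC r (Φ.flow s z) x * σ ^ 3)) := by
  rw [pexC_eq, hE.deriv_eq (h.rhoC_sigma_mem_Ioo hσ hc hη hs x)]

/-- On the regular event inside the band, `|p_ex| ≤ ρ_rθ_r · η₁K`, `K` the bound of `|f_ex′|` on `[cσ³, η₁]`
(so `|Z − 1| ≤ η₁ K` there): the excess-pressure work `T₂smooth` has a bounded, junk-free integrand. [folklore] -/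
theorem Regular.abs_pexC_le {σ r τ c η₁ η₀ : ℝ} {F : ℝ → ℝ} {Φ : Flow σ N} {z : Phase N}
    (hE : EosBand η₀ F) (h : Regular σ r τ c η₁ Φ z) (hσ : 0 < σ) (hc : 0 < c) (hη : η₁ < η₀) :
    ∃ K : ℝ, 0 ≤ K ∧ ∀ s ∈ Set.Icc (0 : ℝ) τ, ∀ x : T3,
      |pexC σ r (Φ.flow s z) x| ≤ rhoC r (Φ.flow s z) x * thetaC r (Φ.flow s z) x * (η₁ * K) := by
  obtain ⟨K, hK0, hK⟩ := hE.exists_bound (mul_pos hc (pow_pos hσ 3)) hη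
  refine ⟨K, hK0, fun s hs x => ?_⟩
  have hm := h.rhoC_sigma_mem hσ hs x
  have hρ : 0 ≤ rhoC r (Φ.flow s z) x := hc.le.trans (h.rhoC_ge hs x)
  have hθ : 0 ≤ thetaC r (Φ.flow s z) x := hc.le.trans (h.thetaC_ge hs x)
  rw [pexC_eq_compressibility, abs_mul, abs_of_nonneg (mul_nonneg hρ hθ)]
  exact mul_le_mul_of_nonneg_left (hK _ hm).2 (mul_nonneg hρ hθ)

/-! ## 3. The thermodynamic cancellation behind P2 -/

/-- **Enskog pressure cancellation.**  With EvenStressEnskog's contact value `Y(η) = (3/(2π)) f_ex′(η)` and the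
local-Maxwellian (isotropic) value `(4π/3)ρ²θ δ_{kl}` of the pair functional `B^{kl}` of the mark
`Ξ_P^{kl} = ((w−v)·n̂)₊ n̂ₖn̂ₗ` (`∫((w−v)·ω)₊² ωₖωₗ dω = (2π/15)(|w−v|²δ_{kl} + 2(w−v)ₖ(w−v)ₗ)`, second moments
`⟨|v₁−v₂|²⟩ = 6θ`), the Enskog value of the collisional pressure (half the ordered-pair statistic) is EXACTLY the
thermodynamic excess pressure: `½ σ³ Y(ρσ³) (4π/3)ρ²θ = ρθ(Z(ρσ³) − 1)`, by `Z(η) = 1 + η f_ex′(η)`. [folklore] -/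
theorem enskog_pressure_cancellation :
  ∀ σ ρ θ : ℝ, 1 / 2 * σ ^ 3 * (3 / (2 * Real.pi) * deriv hsExcessFreeEnergy (ρ * σ ^ 3)) * (4 * Real.pi / 3 * ρ ^ 2 * θ) = ρ * θ * (hsCompressibility (ρ * σ ^ 3) - 1) := by
  intro σ ρ θ
  unfold hsCompressibility
  field_simp; ring

/-- The same cancellation against `hsPressure`: `½ σ³ Y (4π/3)ρ²θ = hsPressure σ ρ θ − ρθ = p_ex`. [folklore] -/
theorem enskog_pressure_cancellation' (σ ρ θ : ℝ) :
    1 / 2 * σ ^ 3 * (3 / (2 * Real.pi) * deriv hsExcessFreeEnergy (ρ * σ ^ 3)) *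
        (4 * Real.pi / 3 * ρ ^ 2 * θ) =
      hsPressure σ ρ θ - ρ * θ := by
  rw [enskog_pressure_cancellation, hsPressure]
  ring

/-- **Closed form of the Enskog collisional stress at a general (anisotropic) coarse state.**  With the full
pair functional `B^{kl} = (4π/3)ρ²θ δ_{kl} + (8π/15)ρ Σ^dev_{kl}` (second moments `∫∫ b b (v₁−v₂)ₖ(v₁−v₂)ₗ =
2ρ(Σ^dev_{kl} + ρθδ_{kl})`, `tr Σ^dev = 0`), the Enskog stress `½σ³ Y B^{kl}` equals
`ρθ(Z − 1)δ_{kl} + (2/5)(Z − 1)Σ^dev_{kl}`: the isotropic part is the thermodynamic `p_ex`, the remainder is a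
`(2/5)(Z−1)`-multiple of the traceless kinetic stress — so `T₂` reduces to a `(Z−1)`-weighted copy of `T₁`.
[folklore] -/
theorem enskog_stress_closed_form (σ ρ θ D δ : ℝ) :
    1 / 2 * σ ^ 3 * (3 / (2 * Real.pi) * deriv hsExcessFreeEnergy (ρ * σ ^ 3)) *
        (4 * Real.pi / 3 * ρ ^ 2 * θ * δ + 8 * Real.pi / 15 * ρ * D) =
      ρ * θ * (hsCompressibility (ρ * σ ^ 3) - 1) * δ +
        2 / 5 * (hsCompressibility (ρ * σ ^ 3) - 1) * D := by
  unfold hsCompressibility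
  field_simp; ring

end Summit.AtomisticToContinuum.HydrodynamicLimit.Theorems.LocalSecondLawLedger

end
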